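import Literature.Probability.LatticeModels.SMTOfStrongMixing
import Literature.Probability.LatticeModels.StrongMixingEffectiveness
import HarnessLib

/-!
# Strong mixing ⇔ `SMT` on the multiples of a cube ([Mar99] Theorem 2.7), DISCHARGED

Topic `Literature/Probability/LatticeModels`; cell `ym-ir`, seat lit-3 (census rows B2/B4).  The assembly of the
discharge of the named fact `Martinelli1999_strongMixing_iff_SMT` of `StrongMixingFiniteSize.lean` ([Mar99]
Theorem 2.7: for a finite-range translation-invariant `±1` spin system, strong mixing `SM(Λ, C, m)` on all
multiples of some `Q_{L₀}` is equivalent to `SMT(Λ, l, m)` on all multiples of some `Q_{L₀}`):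
`theorem Martinelli1999_strongMixing_iff_SMT_holds : Martinelli1999_strongMixing_iff_SMT U`, no new named fact
(D-0026).  The two halves are tree theorems: (ii) ⇒ (i) is `Glauber.strongMixing_of_SMT'`
(`StrongMixingOfSMT.lean`, Lemma 2.8 route), (i) ⇒ (ii) is `Glauber.SMT_of_strongMixing` + Proposition 2.9,
packaged as `Glauber.strongMixing_iff_SMT_of_effectiveness` (`SMTOfStrongMixing.lean`), and Proposition 2.9 is
`Martinelli1999_effectiveness_holds` (`StrongMixingEffectiveness.lean`).  SIBLING-SETTING result (`ℤ^d` lattice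
spin systems); nothing here is a statement about gauge theories, and the Yang–Mills mass gap is not touched by it.

Source (held; `book:bertoin1999-lectures-probability-theory-statistics`): [Mar99] F. Martinelli, *Lectures on
Glauber dynamics for discrete spin models*, LNM 1717 (1999), Theorem 2.7 p0158 L19–26, proof p0159–p0160,
Proposition 2.9 p0161. [cite: Martinelli1999, Theorem 2.7]
-/

noncomputable section

namespace Literature.Probability.LatticeModels

/-- **[Mar99] Theorem 2.7 — DISCHARGED**: strong mixing on all multiples of some cube `Q_{L₀}` is equivalent to
the exponential decay of finite-volume covariances (`SMT`) on all multiples of some cube.  Closes the named fact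
`Martinelli1999_strongMixing_iff_SMT` (the binder `U` is the fact's own parameter). [cite: Martinelli1999, Theorem 2.7] -/
theorem Martinelli1999_strongMixing_iff_SMT_holds {d r : ℕ} (U : FRPotential d ℤˣ r) :
    Martinelli1999_strongMixing_iff_SMT U :=
  Glauber.strongMixing_iff_SMT_of_effectiveness U (Martinelli1999_effectiveness_holds U)

end Literature.Probability.LatticeModels

end
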